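import Mathlib
import HarnessLib
import Summits.HubbardSuperconductivity.HubbardSuperconductivity.Theorems.KLProgrammeKLRegimeEngineV17F2ClosersVGQLad
import Summits.HubbardSuperconductivity.HubbardSuperconductivity.Theorems.KLProgrammeKLRegimeEnginePairTransferMemberTowerGrid
import Summits.HubbardSuperconductivity.HubbardSuperconductivity.Theorems.KLProgrammeKLRegimeEngineTwoShellFramePack
import Summits.HubbardSuperconductivity.HubbardSuperconductivity.Theorems.KLProgrammeKLRegimeEnginePairTransferMemberPHTailPhGain
import Summits.HubbardSuperconductivity.HubbardSuperconductivity.Theorems.KLProgrammeKLRegimeEnginePairTransferDLineRoomReading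

/-!
# K3 ENGINE (stmt-HubbardSuperconductivity-20437 `KLRegimeEngineV17F2`, V2 registration 27cd7ed0f55f17c0), row (c) `stub_engine_step_values`:
# binder #8 `hexLadPkg` FROM hsucc-SHAPED ROWS IN GRID-NORMS CURRENCY — **`EngineV8.rowC_hexLadPkg_of_towerGrid hexLadG : <hexLadPkg VERBATIM>`**
# (cell gate-hubbard-kl, seat hubbard-kl-k3c1-p1 g25, technique «composed-map remainder propagation»; item «ROW-(c)-LADSZ-MASSES» stage 3; composes
# `KLRegimeSplit.klmt_htower_family_grid` (…PairTransferMemberTowerGrid) under row (c)'s prefix, the two-shell regime kit DISCHARGED exactly as in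
# `rowC_hexLadPkg_of_towerProfiles` (…VGQLadTowerMP): `rowC_hUu`, `rowC_hGL` (…ClosersVGQDoors), `twoShellFrameAreaAt_klTS` / `klTS_nonneg`,
# `pi_div_four_mul_le_klScale_of_le_nScales_succ`, `tail_regime_readings`)

WHAT.  Sequel of `rowC_hexLadPkg_of_towerProfiles`: **`hexLadG`** = `hexLadMP` with the four scalar kernel-sup rows (`0 ≤ M4`, `‖V (n′+1) t X‖ ≤ M4`, `‖V6 …‖ ≤ M6`, `‖Sg …‖ ≤ M2`)
REPLACED by h5g″'s five GRID rows at `j = n′+1` (`0 ≤ Ng`; the pinned grid kernel norms of `Gg(t) = effAction (Sᵀ·C^K_(Λ(t))·S)(V_N + 𝒩_(K,N))`; the three binomial rows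
`(2p)!/(βL²)·#legs·Σ_(m′ ≥ p) C(2m′,2p)·(√6047)^(2m′−2p)·Ng m′ ≤ M4 | M6 | M2`) — text-identical to `hsucc`'s rows 48/51.  So `hexLadG` = row (c)'s prefix → `∀ n′, n = n′+1 →`
{`∃ m` ×3} ∧ {`Z ≠ 0` on the slice} ∧ for h5g″'s FAMILY PINS and every in-class `Qm`: a priori along the slice · history a priori · (F)(i) model row `η` + cap · smallness of the
named weight · the five grid rows · `RH₁` · `RL₁` · consumer rows {`transferBarRelIdx … n′ n′ Qm ≤ r′`; ONE explicit budget row `FT_ρ[J] + FT_w[η] + FT_w[Tb] ≤ E₁` (as in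
`hexLadMP`: `ρ = klRungProfile`, `J = (Λd)½RH + M4²·ENV_d + M4²·ENV_x + 2·M6M2·ENV_6 + RL` with the «PH-PROFILE»/born envelopes at `A = klTS`); `E₁ ≤ e₁`; the (E2-F2) slot line}.
Every E1 row of `hexLadG` is then a TEXT-TWIN of an hsucc(95) member row at `j = n′+1` (binder #4's currency: grid norms, not sups); the rest is (c)-closer arithmetic.
A banked lineage level (the nominated v17 candidate is `hexLadMP` / `_pkg₁₄`); fold, if ever, via `…ClosersVGQPkgIMG` on the registrant's / pen's word only.  Plumbing only;
every row of `hexLadG` is a producer HYPOTHESIS (class #1 / (c) closer / k3c2-p2 (F)(i) / #18); nothing here asserts (c), any open row of 20437, K3, U₀, the window or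
superconductivity.  0 kit · 0 lit.
-/

noncomputable section

namespace Summit.HubbardSuperconductivity.HubbardSuperconductivity.Theorems.EngineV8

set_option linter.dupNamespace false -- summit = problem name (single-conjunct summit), D-0017

open Real Set Finset Complex Matrix Literature.MathematicalPhysics.QuantumLattice GrassmannAlgebra
open Literature.Probability.LatticeModels hiding torusSupNorm
open Literature.MathematicalPhysics.QuantumLattice.FermiRG
open Summit.HubbardSuperconductivity.HubbardSuperconductivity.Theorems.KLProgrammeLegKernels
open Summit.HubbardSuperconductivity.HubbardSuperconductivity.Theorems.TwoPointAssembly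
open Summit.HubbardSuperconductivity.HubbardSuperconductivity.Theorems.DispersionFlow
open Summit.HubbardSuperconductivity.HubbardSuperconductivity.Theorems.KLRegimeWick
open Summit.HubbardSuperconductivity.HubbardSuperconductivity.Theorems.KLRegimeSplit

section LadTowerG

set_option maxHeartbeats 3200000 in -- two very long binder lists (row (c)'s prefix + the profile-form rows / the verbatim `hexLadPkg` type); plumbing only
/-- **Binder #8 `hexLadPkg` from hsucc-shaped rows in grid-norms currency** (see the module docstring): the conclusion is `hexLadPkg`'s type VERBATIM. -/
theorem rowC_hexLadPkg_of_towerGrid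
    (hexLadG : ∀ (P : SplitConsts) (R : RenConsts) (c : ℝ), P.WF → R.WF2 → 0 < c → c ≤ klEngC₃7GU klEngGeo14 P R →
          ∀ μ ∈ klWindowC, ∀ U : ℝ, 0 < U → U ≤ klEngU₀12GQ klEngGeo14 (klEngQ9dG klEngGeo14 P R) P R c → ∀ β : ℝ, klBetaMin ≤ β → β ≤ Real.exp (c / U ^ 2) →
            ∀ (L M : ℕ) [NeZero L] [NeZero M], klEngL₄ P R β U ≤ L → klEngM₃ β U L ≤ M →
              ∀ n : ℕ, 1 ≤ n → n ≤ nScales β + 1 → IsKLRegime U c (-(n : ℤ)) →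
                HistP klPredsV17F2 L M klEngGeo14 P (klEngQ9dG klEngGeo14 P R) R β U μ 0 n →
                  FrameOK R U (nScales β) μ (klFlowFrameU L M β U μ n) →
                    KernelNormsV4 L M P (klEngQ9dG klEngGeo14 P R) β U μ (klFlowFrameU L M β U μ n) n →
                      (∀ j ≤ n, (KernelNormsLevels L M P (klEngQ9dG klEngGeo14 P R) β U μ (klFlowFrameU L M β U μ n) j ∧
                        KernelNormsWt4 L M (klWtBudget P (klEngQ9dG klEngGeo14 P R) U j) β U μ (klFlowFrameU L M β U μ n) j)) →
                        (∀ j ≤ n, LevelsUExportMixedAt L M (klCU2 P R (klEngQ7 P R)) P β U μ j) →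
                          (∀ j ≤ n, IsoTupleLineBAt L M klE5AM klE5cM (klE5dM P R) P β U μ j) →
                            (∀ j ≤ n, PairTransferRelFamilyK5 L M klEngGeoTh P (klCT8 P R (klEngQ7 P R) klEngGeo14 klEngGeoTh) β U μ j) →
            ∀ n' : ℕ, n = n' + 1 →
            ∃ m : ℝ, 0 ≤ m ∧ (∀ Qm s t, ‖klPairArrayF L M β U μ n' Qm s t‖ ≤ m) ∧ m * (klEngGeo14.bhi / 4) ≤ 1 / 3 ∧
              (∀ Λ ∈ Icc (klScale klE0 (n' + 1)) (klScale klE0 n'), hubbardEffPartitionFnCT L M β U μ 0 (klFlowFrameU L M β U μ (n' + 1)) Λ ≠ 0) ∧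
              ∀ (A A' : ℕ → TorusSite 2 L → ℝ → Matrix (TorusSite 2 L) (TorusSite 2 L) ℂ) (b b' : ℕ → TorusSite 2 L → ℝ → TorusSite 2 L → ℂ) (ρ : ℕ → TorusSite 2 L → TorusSite 2 L → ℝ) (V : ℕ → ℝ → (Fin 4 → HubbardFieldIdx L M) → ℂ) (V6 : ℕ → ℝ → (Fin 6 → HubbardFieldIdx L M) → ℂ) (Sg : ℕ → ℝ → FreqMomentum L M → Fin 2 → ℂ) (Hd : ℕ → ℝ → (Fin 4 → HubbardFieldIdx L M) → ℂ) (Φ : ℕ → ℝ → FreqMomentum L M → ℝ) (Wd : ℝ → FreqMomentum L M → ℝ) (Br : ℕ → TorusSite 2 L → ℝ → TorusSite 2 L × MatsubaraIdx M → ℂ),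
      (A = fun j Qm t => Matrix.of fun k k' : TorusSite 2 L => if k ∈ klBall L μ 0 ∧ k' ∈ klBall L μ 0 then vertexFn L M β (gaussConv ℂ (softCovOf L M β μ (klFlowFrameU L M β U μ (n' + 1)) (softSymbolCompl L M β μ (klFlowFrameU L M β U μ (n' + 1)) (n' + 1) j) + hubbardCovAboveCT L M β μ 0 (klFlowFrameU L M β U μ (n' + 1)) (klScale klE0 (n' + 1)) - hubbardCovAboveCT L M β μ 0 (klFlowFrameU L M β U μ (n' + 1)) (klScale klE0 n' + t * (klScale klE0 (n' + 1) - klScale klE0 n'))) (hubbardEffectiveActionCT L M β U μ 0 (klFlowFrameU L M β U μ (n' + 1)) (klScale klE0 n' + t * (klScale klE0 (n' + 1) - klScale klE0 n')))) 4 ![(((omega0 M, k'), 0), 0), ((((omega0 M).rev, Qm - k'), 1), 0), ((((omega0 M).rev, Qm - k), 1), 1), (((omega0 M, k), 0), 1)] else 0) →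
      (A' = fun j Qm t => Matrix.of fun k k' : TorusSite 2 L => if k ∈ klBall L μ 0 ∧ k' ∈ klBall L μ 0 then (klScale klE0 (n' + 1) - klScale klE0 n') • -((2 : ℂ)⁻¹ * vertexFn L M β (gaussConv ℂ (softCovOf L M β μ (klFlowFrameU L M β U μ (n' + 1)) (softSymbolCompl L M β μ (klFlowFrameU L M β U μ (n' + 1)) (n' + 1) j) + hubbardCovAboveCT L M β μ 0 (klFlowFrameU L M β U μ (n' + 1)) (klScale klE0 (n' + 1)) - hubbardCovAboveCT L M β μ 0 (klFlowFrameU L M β U μ (n' + 1)) (klScale klE0 n' + t * (klScale klE0 (n' + 1) - klScale klE0 n'))) (grassmannDerivPairing ℂ (Matrix.of fun X Y : HubbardFieldIdx L M => deriv (fun Λ'' : ℝ => hubbardCovAboveCT L M β μ 0 (klFlowFrameU L M β U μ (n' + 1)) Λ'' X Y) (klScale klE0 n' + t * (klScale klE0 (n' + 1) - klScale klE0 n'))) (hubbardEffectiveActionCT L M β U μ 0 (klFlowFrameU L M β U μ (n' + 1)) (klScale klE0 n' + t * (klScale klE0 (n' + 1) - klScale klE0 n'))) (hubbardEffectiveActionCT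 L M β U μ 0 (klFlowFrameU L M β U μ (n' + 1)) (klScale klE0 n' + t * (klScale klE0 (n' + 1) - klScale klE0 n'))))) 4 ![(((omega0 M, k'), 0), 0), ((((omega0 M).rev, Qm - k'), 1), 0), ((((omega0 M).rev, Qm - k), 1), 1), (((omega0 M, k), 0), 1)]) else 0) →
      (b = fun j Qm t p => -((klBubbleMass L M β μ (klFlowFrameU L M β U μ (n' + 1)) (fun k => (softSymbolCompl L M β μ (klFlowFrameU L M β U μ (n' + 1)) (n' + 1) j) k + (hubbardCutoffWeightCT L M β μ (klFlowFrameU L M β U μ (n' + 1)) (klScale klE0 (n' + 1)) k - hubbardCutoffWeightCT L M β μ (klFlowFrameU L M β U μ (n' + 1)) (klScale klE0 n' + t * (klScale klE0 (n' + 1) - klScale klE0 n')) k)) (fun k => (softSymbolCompl L M β μ (klFlowFrameU L M β U μ (n' + 1)) (n' + 1) j) k + (hubbardCutoffWeightCT L M β μ (klFlowFrameU L M β U μ (n' + 1)) (klScale klE0 (n' + 1)) k - hubbardCutoffWeightCT L M β μ (klFlowFrameU L M β U μ (n' + 1)) (klScale klE0 n' + t * (klScale klE0 (n' + 1) - klScale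 klE0 n')) k)) Qm p : ℝ) : ℂ)) →
      (b' = fun j Qm t p => (((klScale klE0 (n' + 1) - klScale klE0 n') * (klBubbleMass L M β μ (klFlowFrameU L M β U μ (n' + 1)) (fun k => deriv (fun Λ' => hubbardCutoffWeightCT L M β μ (klFlowFrameU L M β U μ (n' + 1)) Λ' k) (klScale klE0 n' + t * (klScale klE0 (n' + 1) - klScale klE0 n'))) (fun k => (softSymbolCompl L M β μ (klFlowFrameU L M β U μ (n' + 1)) (n' + 1) j) k + (hubbardCutoffWeightCT L M β μ (klFlowFrameU L M β U μ (n' + 1)) (klScale klE0 (n' + 1)) k - hubbardCutoffWeightCT L M β μ (klFlowFrameU L M β U μ (n' + 1)) (klScale klE0 n' + t * (klScale klE0 (n' + 1) - klScale klE0 n')) k)) Qm p + klBubbleMass L M β μ (klFlowFrameU L M β U μ (n' + 1)) (fun k => (softSymbolCompl L M β μ (klFlowFrameU L M β U μ (n' + 1)) (n' + 1) j) k + (hubbardCutoffWeightCT L M β μ (klFlowFrameU L M β U μ (n' + 1)) (klScale klE0 (n' + 1)) k - hubbardCutoffWeightCT L M β μ (klFlowFrameU L M β U μ (n' + 1)) (klScale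 klE0 n' + t * (klScale klE0 (n' + 1) - klScale klE0 n')) k)) (fun k => deriv (fun Λ' => hubbardCutoffWeightCT L M β μ (klFlowFrameU L M β U μ (n' + 1)) Λ' k) (klScale klE0 n' + t * (klScale klE0 (n' + 1) - klScale klE0 n'))) Qm p) : ℝ) : ℂ)) →
      (ρ = fun j Qm c => klRungProfile L M β μ (klFlowFrameU L M β U μ (n' + 1)) n' (softSymbolCompl L M β μ (klFlowFrameU L M β U μ (n' + 1)) (n' + 1) j) Qm c) →
      (V = fun j t X => vertexFn L M β (gaussConv ℂ (softCovOf L M β μ (klFlowFrameU L M β U μ (n' + 1)) (softSymbolCompl L M β μ (klFlowFrameU L M β U μ (n' + 1)) (n' + 1) j) + hubbardCovAboveCT L M β μ 0 (klFlowFrameU L M β U μ (n' + 1)) (klScale klE0 (n' + 1)) - hubbardCovAboveCT L M β μ 0 (klFlowFrameU L M β U μ (n' + 1)) (klScale klE0 n' + t * (klScale klE0 (n' + 1) - klScale klE0 n'))) (hubbardEffectiveActionCT L M β U μ 0 (klFlowFrameU L M β U μ (n' + 1)) (klScale klE0 n' + t * (klScale klE0 (n' + 1) - klScale klE0 n'))))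 4 X) →
      (V6 = fun j t X => vertexFn L M β (gaussConv ℂ (softCovOf L M β μ (klFlowFrameU L M β U μ (n' + 1)) (softSymbolCompl L M β μ (klFlowFrameU L M β U μ (n' + 1)) (n' + 1) j) + hubbardCovAboveCT L M β μ 0 (klFlowFrameU L M β U μ (n' + 1)) (klScale klE0 (n' + 1)) - hubbardCovAboveCT L M β μ 0 (klFlowFrameU L M β U μ (n' + 1)) (klScale klE0 n' + t * (klScale klE0 (n' + 1) - klScale klE0 n'))) (hubbardEffectiveActionCT L M β U μ 0 (klFlowFrameU L M β U μ (n' + 1)) (klScale klE0 n' + t * (klScale klE0 (n' + 1) - klScale klE0 n')))) 6 X) →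
      (Sg = fun j t p σ => selfEnergy L M β (gaussConv ℂ (softCovOf L M β μ (klFlowFrameU L M β U μ (n' + 1)) (softSymbolCompl L M β μ (klFlowFrameU L M β U μ (n' + 1)) (n' + 1) j) + hubbardCovAboveCT L M β μ 0 (klFlowFrameU L M β U μ (n' + 1)) (klScale klE0 (n' + 1)) - hubbardCovAboveCT L M β μ 0 (klFlowFrameU L M β U μ (n' + 1)) (klScale klE0 n' + t * (klScale klE0 (n' + 1) - klScale klE0 n'))) (hubbardEffectiveActionCT L M β U μ 0 (klFlowFrameU L M β U μ (n' + 1)) (klScale klE0 n' + t * (klScale klE0 (n' + 1) - klScale klE0 n')))) p σ) →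
      (Hd = fun j t X => vertexFn L M β (dblFold ℂ (grassmannLaplacian ℂ (crossCov ℂ (Matrix.of fun X Y : HubbardFieldIdx L M => deriv (fun Λ' : ℝ => hubbardCovAboveCT L M β μ 0 (klFlowFrameU L M β U μ (n' + 1)) Λ' X Y) (klScale klE0 n' + t * (klScale klE0 (n' + 1) - klScale klE0 n')))) ((gaussConv ℂ (crossCov ℂ (softCovOf L M β μ (klFlowFrameU L M β U μ (n' + 1)) (softSymbolCompl L M β μ (klFlowFrameU L M β U μ (n' + 1)) (n' + 1) j) + hubbardCovAboveCT L M β μ 0 (klFlowFrameU L M β U μ (n' + 1)) (klScale klE0 (n' + 1)) - hubbardCovAboveCT L M β μ 0 (klFlowFrameU L M β U μ (n' + 1)) (klScale klE0 n' + t * (klScale klE0 (n' + 1) - klScale klE0 n')))) - grassmannLaplacian ℂ (crossCov ℂ (softCovOf L M β μ (klFlowFrameU L M β U μ (n' + 1)) (softSymbolCompl L M β μ (klFlowFrameU L M β U μ (n' + 1)) (n' + 1) j) + hubbardCovAboveCT L M β μ 0 (klFlowFrameU L M β U μ (n' + 1)) (klScale klE0 (n' + 1)) - hubbardCovAboveCT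 L M β μ 0 (klFlowFrameU L M β U μ (n' + 1)) (klScale klE0 n' + t * (klScale klE0 (n' + 1) - klScale klE0 n'))))) (dblCopy ℂ 0 (gaussConv ℂ (softCovOf L M β μ (klFlowFrameU L M β U μ (n' + 1)) (softSymbolCompl L M β μ (klFlowFrameU L M β U μ (n' + 1)) (n' + 1) j) + hubbardCovAboveCT L M β μ 0 (klFlowFrameU L M β U μ (n' + 1)) (klScale klE0 (n' + 1)) - hubbardCovAboveCT L M β μ 0 (klFlowFrameU L M β U μ (n' + 1)) (klScale klE0 n' + t * (klScale klE0 (n' + 1) - klScale klE0 n'))) (hubbardEffectiveActionCT L M β U μ 0 (klFlowFrameU L M β U μ (n' + 1)) (klScale klE0 n' + t * (klScale klE0 (n' + 1) - klScale klE0 n')))) * dblCopy ℂ 1 (gaussConv ℂ (softCovOf L M β μ (klFlowFrameU L M β U μ (n' + 1)) (softSymbolCompl L M β μ (klFlowFrameU L M β U μ (n' + 1)) (n' + 1) j) + hubbardCovAboveCT L M β μ 0 (klFlowFrameU L M β U μ (n' + 1)) (klScale klE0 (n' + 1)) - hubbardCovAboveCT L M β μ 0 (klFlowFrameU L M β U μ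 (n' + 1)) (klScale klE0 n' + t * (klScale klE0 (n' + 1) - klScale klE0 n'))) (hubbardEffectiveActionCT L M β U μ 0 (klFlowFrameU L M β U μ (n' + 1)) (klScale klE0 n' + t * (klScale klE0 (n' + 1) - klScale klE0 n')))))))) 4 X) →
      (Φ = fun j t k => (softSymbolCompl L M β μ (klFlowFrameU L M β U μ (n' + 1)) (n' + 1) j) k + (hubbardCutoffWeightCT L M β μ (klFlowFrameU L M β U μ (n' + 1)) (klScale klE0 (n' + 1)) k - hubbardCutoffWeightCT L M β μ (klFlowFrameU L M β U μ (n' + 1)) (klScale klE0 n' + t * (klScale klE0 (n' + 1) - klScale klE0 n')) k)) →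
      (Wd = fun t k => deriv (fun Λ' : ℝ => hubbardCutoffWeightCT L M β μ (klFlowFrameU L M β U μ (n' + 1)) Λ' k) (klScale klE0 n' + t * (klScale klE0 (n' + 1) - klScale klE0 n'))) →
      (Br = fun j Qm t z => -(((((β * (L : ℝ) ^ 2 : ℝ) : ℂ)))⁻¹ * propCT L M β μ (klFlowFrameU L M β U μ (n' + 1)) (z.2, z.1) * propCT L M β μ (klFlowFrameU L M β U μ (n' + 1)) (z.2.rev, Qm - z.1)) * ((((klScale klE0 (n' + 1) - klScale klE0 n') * (-Wd t (z.2, z.1) * Φ j t (z.2.rev, Qm - z.1) - Φ j t (z.2, z.1) * Wd t (z.2.rev, Qm - z.1))) : ℝ) : ℂ)) →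
      ∀ Qm : TorusSite 2 L, IsPairClassAt L Qm (n' + 1) →
      ∃ (r' e₁ M4 M6 M2 : ℝ) (η E₁ RH RL : TorusSite 2 L → TorusSite 2 L → ℝ) (Ng : ℕ → ℝ), 0 ≤ r' ∧ 0 ≤ e₁ ∧
        -- a priori along the slice; history a priori [class #1]
        (∀ t ∈ Icc (0 : ℝ) 1, ∀ x y, ‖A (n' + 1) Qm t x y‖ ≤ m) ∧
        (∀ x y, ‖klMemberArrayF L M β U μ n' (softSymbolCompl L M β μ (klFlowFrameU L M β U μ n') n' (n' + 1)) Qm x y‖ ≤ m) ∧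
        -- (F)(i): majorant of the FRAME SHIFT `K_n → K_(n'+1)` of the history member (model objects) + its scalar cap [k3c2-p2]
        (∀ x y, ‖((Matrix.of fun k k' : TorusSite 2 L => if k ∈ klBall L μ 0 ∧ k' ∈ klBall L μ 0 then klCovSmearedPairAmplitude L M β U μ (klFlowFrameU L M β U μ (n' + 1)) n' (softCovOf L M β μ (klFlowFrameU L M β U μ (n' + 1)) (softSymbolCompl L M β μ (klFlowFrameU L M β U μ (n' + 1)) n' (n' + 1))) Qm k k' else 0) - klMemberArrayF L M β U μ n' (softSymbolCompl L M β μ (klFlowFrameU L M β U μ n') n' (n' + 1)) Qm) x y‖ ≤ η x y) ∧ (∀ x y, η x y ≤ r') ∧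
        -- smallness of the NAMED tower weight
        (3 / 2 * m + r') * ∑ p, |klSliceWeightSmeared L M β μ (klFlowFrameU L M β U μ (n' + 1)) (n' + 1) (fun _ => (0 : ℝ)) Qm p| ≤ 1 / 3 ∧
        -- class-#1 kernel inputs IN GRID-NORMS CURRENCY (hsucc's rows 48/51 at `j = n'+1`): the pinned GRID kernel norms `Ng` of `Gg(t) = effAction (SᵀC^K_(Λ(t))S)(V_N + 𝒩_(K,N))` and the
        -- three binomial numbers they produce (`γ := √6047` discharged by `klmg_isGramBoundedR_gridSub_runningSymbol`)
        (∀ m', 0 ≤ Ng m') ∧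
        (∀ t ∈ Icc (0 : ℝ) 1, ∀ m' (i : Fin (2 * m')) (w : GridLeg (GridPoint L (2 * (2 * M)))), ∑ Y ∈ univ.filter (fun Y : Fin (2 * m') → GridLeg (GridPoint L (2 * (2 * M))) => Y i = w), ‖kernel ℂ (effAction ℂ ((hubbardGridSub L M β (2 * (2 * M))).transpose * hubbardCovAboveCT L M β μ 0 (klFlowFrameU L M β U μ (n' + 1)) (klScale klE0 n' + t * (klScale klE0 (n' + 1) - klScale klE0 n')) * hubbardGridSub L M β (2 * (2 * M))) (hubbardGridInteraction L (2 * (2 * M)) β U + hubbardGridCounterQuadratic L (2 * (2 * M)) β (klFlowFrameU L M β U μ (n' + 1)))) (2 * m') Y‖ ≤ Ng m') ∧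
        (((2 * 2).factorial : ℝ) / (β * (L : ℝ) ^ 2) * (Fintype.card (GridLeg (GridPoint L (2 * (2 * M)))) * ∑ m' ∈ range (Fintype.card (GridLeg (GridPoint L (2 * (2 * M)))) / 2 + 1), if 2 ≤ m' then ((2 * m').choose (2 * 2) : ℝ) * Real.sqrt 6047 ^ (2 * m' - 2 * 2) * Ng m' else 0) ≤ M4) ∧
        (((2 * 3).factorial : ℝ) / (β * (L : ℝ) ^ 2) * (Fintype.card (GridLeg (GridPoint L (2 * (2 * M)))) * ∑ m' ∈ range (Fintype.card (GridLeg (GridPoint L (2 * (2 * M)))) / 2 + 1), if 3 ≤ m' then ((2 * m').choose (2 * 3) : ℝ) * Real.sqrt 6047 ^ (2 * m' - 2 * 3) * Ng m' else 0) ≤ M6) ∧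
        (((2 * 1).factorial : ℝ) / (β * (L : ℝ) ^ 2) * (Fintype.card (GridLeg (GridPoint L (2 * (2 * M)))) * ∑ m' ∈ range (Fintype.card (GridLeg (GridPoint L (2 * (2 * M)))) / 2 + 1), if 1 ≤ m' then ((2 * m').choose (2 * 1) : ℝ) * Real.sqrt 6047 ^ (2 * m' - 2 * 1) * Ng m' else 0) ≤ M2) ∧
        -- the «≥ 2 cross lines» class row and the localisation row (hsucc's `RH₁` / `RL₁` at `j = n'+1`)
        (∀ t ∈ Icc (0 : ℝ) 1, ∀ x y : TorusSite 2 L, ‖Hd (n' + 1) t ![(((omega0 M, y), 0), 0), ((((omega0 M).rev, Qm - y), 1), 0), ((((omega0 M).rev, Qm - x), 1), 1), (((omega0 M, x), 0), 1)]‖ ≤ RH x y) ∧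
        (∀ t ∈ Icc (0 : ℝ) 1, ∀ x y : TorusSite 2 L, ‖∑ z : TorusSite 2 L × MatsubaraIdx M, Br (n' + 1) Qm t z * ((if z.1 ∈ klBall L μ 0 then V (n' + 1) t ![(((omega0 M, z.1), 0), 0), ((((omega0 M).rev, Qm - z.1), 1), 0), ((((omega0 M).rev, Qm - x), 1), 1), (((omega0 M, x), 0), 1)] * V (n' + 1) t ![(((omega0 M, y), 0), 0), ((((omega0 M).rev, Qm - y), 1), 0), ((((omega0 M).rev, Qm - z.1), 1), 1), (((omega0 M, z.1), 0), 1)] else 0) - V (n' + 1) t ![(((z.2, z.1), 0), 0), (((z.2.rev, Qm - z.1), 1), 0), ((((omega0 M).rev, Qm - x), 1), 1), (((omega0 M, x), 0), 1)] * V (n' + 1) t ![(((omega0 M, y), 0), 0), ((((omega0 M).rev, Qm - y), 1), 0), (((z.2.rev, Qm - z.1), 1), 1), (((z.2, z.1), 0), 1)])‖ ≤ RL x y) ∧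
        -- consumer-side rows at the class-#5 bar `transferBarRelIdx … (klCT8 …) … n' n'` and the (E2-F2) slot line; the source majorant `FT_ρ[J] + FT_w[η]` is WRITTEN OUT, the member's three weight masses
        -- replaced by their MODEL envelopes («PH-PROFILE» flat core / two-shell tail, flat at `n' = 0`; born flat)
        (∀ x y, transferBarRelIdx L klEngGeoTh P (klCT8 P R (klEngQ7 P R) klEngGeo14 klEngGeoTh) β U n' n' Qm x y ≤ r') ∧
        (∀ x y, ((((klScale klE0 n' - klScale klE0 (n' + 1)) * (2⁻¹ * RH x y + ((β * (L : ℝ) ^ 2) ^ 3)⁻¹ * (M4 * M4 * ((if n' = 0 then (2048 * 15367 : ℝ) else if (4 + 8 / 3 * R.Gfr 1 * U ^ 2) * klTorusNorm L (x - y) < klScale klE0 (n' + 1) / 8 then 2048 * 15367 else 512 / 3 * (27 / (8 * Real.pi ^ 2)) * klTS * (16 / Real.pi) * (10 + 50 * (4 + 8 / 3 * R.Gfr 1 * U ^ 2) * β / L) * (16384 * (4 + 8 / 3 * R.Gfr 1 * U ^ 2) ^ 2 * min (klTorusNorm L (x - y) / klScale klE0 (n' + 1)) (klScale klE0 (n'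 + 1) / klTorusNorm L (x - y)) + Real.sqrt 2 / 4 * ((2 : ℝ) ^ n')⁻¹)) / ((klScale klE0 n' - klScale klE0 (n' + 1)) * ((β * (L : ℝ) ^ 2) ^ 3)⁻¹)) + M4 * M4 * ((if n' = 0 then (1024 * 15367 : ℝ) else if (4 + 8 / 3 * R.Gfr 1 * U ^ 2) * klTorusNorm L (x + y - Qm) < klScale klE0 (n' + 1) / 8 then 1024 * 15367 else 256 / 3 * (27 / (8 * Real.pi ^ 2)) * klTS * (16 / Real.pi) * (10 + 50 * (4 + 8 / 3 * R.Gfr 1 * U ^ 2) * β / L) * (16384 * (4 + 8 / 3 * R.Gfr 1 * U ^ 2) ^ 2 * min (klTorusNorm L (x + y - Qm) / klScale klE0 (n' + 1)) (klScale klE0 (n' + 1) / klTorusNorm L (x + y - Qm)) + Real.sqrt 2 / 4 * ((2 : ℝ) ^ n')⁻¹)) / ((klScale klE0 n' - klScale klE0 (n' + 1)) * ((β * (L : ℝ) ^ 2) ^ 3)⁻¹)) + 2 * (M6 * M2 * ((1024 * 15367 : ℝ) / ((klScale klE0 n' - klScale klE0 (n' + 1)) * ((β * (L : ℝ) ^ 2)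 ^ 3)⁻¹))))) + RL x y) + 3 / 2 * (3 / 2 * m) * ∑ c, ((klScale klE0 n' - klScale klE0 (n' + 1)) * (2⁻¹ * RH x c + ((β * (L : ℝ) ^ 2) ^ 3)⁻¹ * (M4 * M4 * ((if n' = 0 then (2048 * 15367 : ℝ) else if (4 + 8 / 3 * R.Gfr 1 * U ^ 2) * klTorusNorm L (x - c) < klScale klE0 (n' + 1) / 8 then 2048 * 15367 else 512 / 3 * (27 / (8 * Real.pi ^ 2)) * klTS * (16 / Real.pi) * (10 + 50 * (4 + 8 / 3 * R.Gfr 1 * U ^ 2) * β / L) * (16384 * (4 + 8 / 3 * R.Gfr 1 * U ^ 2) ^ 2 * min (klTorusNorm L (x - c) / klScale klE0 (n' + 1)) (klScale klE0 (n' + 1) / klTorusNorm L (x - c)) + Real.sqrt 2 / 4 * ((2 : ℝ) ^ n')⁻¹)) / ((klScale klE0 n' - klScale klE0 (n' + 1)) * ((β * (L : ℝ) ^ 2) ^ 3)⁻¹)) + M4 * M4 * ((if n' = 0 then (1024 * 15367 : ℝ) else if (4 + 8 / 3 * R.Gfr 1 * U ^ 2) * klTorusNorm L (x + c - Qm) <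 klScale klE0 (n' + 1) / 8 then 1024 * 15367 else 256 / 3 * (27 / (8 * Real.pi ^ 2)) * klTS * (16 / Real.pi) * (10 + 50 * (4 + 8 / 3 * R.Gfr 1 * U ^ 2) * β / L) * (16384 * (4 + 8 / 3 * R.Gfr 1 * U ^ 2) ^ 2 * min (klTorusNorm L (x + c - Qm) / klScale klE0 (n' + 1)) (klScale klE0 (n' + 1) / klTorusNorm L (x + c - Qm)) + Real.sqrt 2 / 4 * ((2 : ℝ) ^ n')⁻¹)) / ((klScale klE0 n' - klScale klE0 (n' + 1)) * ((β * (L : ℝ) ^ 2) ^ 3)⁻¹)) + 2 * (M6 * M2 * ((1024 * 15367 : ℝ) / ((klScale klE0 n' - klScale klE0 (n' + 1)) * ((β * (L : ℝ) ^ 2) ^ 3)⁻¹))))) + RL x c) * ρ (n' + 1) Qm c + 3 / 2 * m * ∑ a, ρ (n' + 1) Qm a * ((klScale klE0 n' - klScale klE0 (n' + 1)) * (2⁻¹ * RH a y + ((β * (L : ℝ) ^ 2) ^ 3)⁻¹ * (M4 * M4 * ((if n' = 0 then (2048 * 15367 : ℝ) else if (4 + 8 / 3 * R.Gfr 1 *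 U ^ 2) * klTorusNorm L (a - y) < klScale klE0 (n' + 1) / 8 then 2048 * 15367 else 512 / 3 * (27 / (8 * Real.pi ^ 2)) * klTS * (16 / Real.pi) * (10 + 50 * (4 + 8 / 3 * R.Gfr 1 * U ^ 2) * β / L) * (16384 * (4 + 8 / 3 * R.Gfr 1 * U ^ 2) ^ 2 * min (klTorusNorm L (a - y) / klScale klE0 (n' + 1)) (klScale klE0 (n' + 1) / klTorusNorm L (a - y)) + Real.sqrt 2 / 4 * ((2 : ℝ) ^ n')⁻¹)) / ((klScale klE0 n' - klScale klE0 (n' + 1)) * ((β * (L : ℝ) ^ 2) ^ 3)⁻¹)) + M4 * M4 * ((if n' = 0 then (1024 * 15367 : ℝ) else if (4 + 8 / 3 * R.Gfr 1 * U ^ 2) * klTorusNorm L (a + y - Qm) < klScale klE0 (n' + 1) / 8 then 1024 * 15367 else 256 / 3 * (27 / (8 * Real.pi ^ 2)) * klTS * (16 / Real.pi) * (10 + 50 * (4 + 8 / 3 * R.Gfr 1 * U ^ 2) * β / L) * (16384 * (4 + 8 / 3 * R.Gfr 1 * U ^ 2) ^ 2 * min (klTorusNorm L (a + y - Qm) /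 klScale klE0 (n' + 1)) (klScale klE0 (n' + 1) / klTorusNorm L (a + y - Qm)) + Real.sqrt 2 / 4 * ((2 : ℝ) ^ n')⁻¹)) / ((klScale klE0 n' - klScale klE0 (n' + 1)) * ((β * (L : ℝ) ^ 2) ^ 3)⁻¹)) + 2 * (M6 * M2 * ((1024 * 15367 : ℝ) / ((klScale klE0 n' - klScale klE0 (n' + 1)) * ((β * (L : ℝ) ^ 2) ^ 3)⁻¹))))) + RL a y) + 9 / 4 * m * (3 / 2 * m) * ∑ a, ∑ c, ρ (n' + 1) Qm a * ((klScale klE0 n' - klScale klE0 (n' + 1)) * (2⁻¹ * RH a c + ((β * (L : ℝ) ^ 2) ^ 3)⁻¹ * (M4 * M4 * ((if n' = 0 then (2048 * 15367 : ℝ) else if (4 + 8 / 3 * R.Gfr 1 * U ^ 2) * klTorusNorm L (a - c) < klScale klE0 (n' + 1) / 8 then 2048 * 15367 else 512 / 3 * (27 / (8 * Real.pi ^ 2)) * klTS * (16 / Real.pi) * (10 + 50 * (4 + 8 / 3 * R.Gfr 1 * U ^ 2) * β / L) * (16384 * (4 + 8 / 3 * R.Gfr 1 * U ^ 2) ^ 2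 * min (klTorusNorm L (a - c) / klScale klE0 (n' + 1)) (klScale klE0 (n' + 1) / klTorusNorm L (a - c)) + Real.sqrt 2 / 4 * ((2 : ℝ) ^ n')⁻¹)) / ((klScale klE0 n' - klScale klE0 (n' + 1)) * ((β * (L : ℝ) ^ 2) ^ 3)⁻¹)) + M4 * M4 * ((if n' = 0 then (1024 * 15367 : ℝ) else if (4 + 8 / 3 * R.Gfr 1 * U ^ 2) * klTorusNorm L (a + c - Qm) < klScale klE0 (n' + 1) / 8 then 1024 * 15367 else 256 / 3 * (27 / (8 * Real.pi ^ 2)) * klTS * (16 / Real.pi) * (10 + 50 * (4 + 8 / 3 * R.Gfr 1 * U ^ 2) * β / L) * (16384 * (4 + 8 / 3 * R.Gfr 1 * U ^ 2) ^ 2 * min (klTorusNorm L (a + c - Qm) / klScale klE0 (n' + 1)) (klScale klE0 (n' + 1) / klTorusNorm L (a + c - Qm)) + Real.sqrt 2 / 4 * ((2 : ℝ) ^ n')⁻¹)) / ((klScale klE0 n' - klScale klE0 (n' + 1)) * ((β * (L : ℝ) ^ 2) ^ 3)⁻¹)) + 2 * (M6 * M2 * ((1024 * 15367 : ℝ) /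 ((klScale klE0 n' - klScale klE0 (n' + 1)) * ((β * (L : ℝ) ^ 2) ^ 3)⁻¹))))) + RL a c) * ρ (n' + 1) Qm c) +
            (η x y + 3 / 2 * (3 / 2 * m) * ∑ t, η x t * |klSliceWeightSmeared L M β μ (klFlowFrameU L M β U μ (n' + 1)) (n' + 1) (fun _ => (0 : ℝ)) Qm t| + 3 / 2 * (3 / 2 * m + r') * ∑ a, |klSliceWeightSmeared L M β μ (klFlowFrameU L M β U μ (n' + 1)) (n' + 1) (fun _ => (0 : ℝ)) Qm a| * η a y + 9 / 4 * (3 / 2 * m + r') * (3 / 2 * m) * ∑ a, ∑ t, |klSliceWeightSmeared L M β μ (klFlowFrameU L M β U μ (n' + 1)) (n' + 1) (fun _ => (0 : ℝ)) Qm a| * η a t * |klSliceWeightSmeared L M β μ (klFlowFrameU L M β U μ (n' + 1)) (n' + 1) (fun _ => (0 : ℝ)) Qm t|)) +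
          (transferBarRelIdx L klEngGeoTh P (klCT8 P R (klEngQ7 P R) klEngGeo14 klEngGeoTh) β U n' n' Qm x y + 3 / 2 * (3 / 2 * m) * ∑ t, transferBarRelIdx L klEngGeoTh P (klCT8 P R (klEngQ7 P R) klEngGeo14 klEngGeoTh) β U n' n' Qm x t * |klSliceWeightSmeared L M β μ (klFlowFrameU L M β U μ (n' + 1)) (n' + 1) (fun _ => (0 : ℝ)) Qm t| + 3 / 2 * (3 / 2 * m + r') * ∑ a, |klSliceWeightSmeared L M β μ (klFlowFrameU L M β U μ (n' + 1)) (n' + 1) (fun _ => (0 : ℝ)) Qm a| * transferBarRelIdx L klEngGeoTh P (klCT8 P R (klEngQ7 P R) klEngGeo14 klEngGeoTh) β U n' n' Qm a y + 9 / 4 * (3 / 2 * m + r') * (3 / 2 * m) * ∑ a, ∑ t, |klSliceWeightSmeared L M β μ (klFlowFrameU L M β U μ (n' + 1)) (n' + 1) (fun _ => (0 : ℝ)) Qm a| * transferBarRelIdx L klEngGeoTh P (klCT8 P R (klEngQ7 P R) klEngGeo14 klEngGeoTh) β U n' n' Qm a t * |klSliceWeightSmeared L M β μ (klFlowFrameU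 L M β U μ (n' + 1)) (n' + 1) (fun _ => (0 : ℝ)) Qm t|) ≤ E₁ x y) ∧
        (∀ x y, E₁ x y ≤ e₁) ∧
        (∀ k ∈ klBall L μ 0, ∀ k' ∈ klBall L μ 0, E₁ k k' ≤ drivePBar klEngGeo14 P U n' + eremBar klEngGeo14 P (klEngQ9dG klEngGeo14 P R) U β L n' + thermalBar klEngGeo14 P U β (n' + 1) +
              legDressBarQ2 klEngGeo14 P (klEngQ9dG klEngGeo14 P R) U (n' + 1) (legSliceCountT L β μ (klFlowFrameU L M β U μ (n' + 1)) (n' + 1) ![k', Qm - k', Qm - k, k]) +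
              (P.Klam * U) ^ 2 * (klEngGeo14.phGain (n' + 1) (klTorusNorm L (k - k')) + klEngGeo14.phGain (n' + 1) (klTorusNorm L (k + k' - Qm))) +
              frameShiftBar P (klEngQ9dG klEngGeo14 P R) U (n' + 1))) :
    ∀ (P : SplitConsts) (R : RenConsts) (c : ℝ), P.WF → R.WF2 → 0 < c → c ≤ klEngC₃7GU klEngGeo14 P R →
          ∀ μ ∈ klWindowC, ∀ U : ℝ, 0 < U → U ≤ klEngU₀12GQ klEngGeo14 (klEngQ9dG klEngGeo14 P R) P R c → ∀ β : ℝ, klBetaMin ≤ β → β ≤ Real.exp (c / U ^ 2) →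
            ∀ (L M : ℕ) [NeZero L] [NeZero M], klEngL₄ P R β U ≤ L → klEngM₃ β U L ≤ M →
              ∀ n : ℕ, 1 ≤ n → n ≤ nScales β + 1 → IsKLRegime U c (-(n : ℤ)) →
                HistP klPredsV17F2 L M klEngGeo14 P (klEngQ9dG klEngGeo14 P R) R β U μ 0 n →
                  FrameOK R U (nScales β) μ (klFlowFrameU L M β U μ n) →
                    KernelNormsV4 L M P (klEngQ9dG klEngGeo14 P R) β U μ (klFlowFrameU L M β U μ n) n →
                      (∀ j ≤ n, (KernelNormsLevels L M P (klEngQ9dG klEngGeo14 P R) β U μ (klFlowFrameU L M β U μ n) j ∧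
                        KernelNormsWt4 L M (klWtBudget P (klEngQ9dG klEngGeo14 P R) U j) β U μ (klFlowFrameU L M β U μ n) j)) →
                        (∀ j ≤ n, LevelsUExportMixedAt L M (klCU2 P R (klEngQ7 P R)) P β U μ j) →
                          (∀ j ≤ n, IsoTupleLineBAt L M klE5AM klE5cM (klE5dM P R) P β U μ j) →
                            (∀ j ≤ n, PairTransferRelFamilyK5 L M klEngGeoTh P (klCT8 P R (klEngQ7 P R) klEngGeo14 klEngGeoTh) β U μ j) →
            ∃ m : ℝ, 0 ≤ m ∧ (∀ Qm s t, ‖klPairArrayF L M β U μ (n - 1) Qm s t‖ ≤ m) ∧ m * (klEngGeo14.bhi / 4) ≤ 1 / 3 ∧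
              (∀ Qm : TorusSite 2 L, IsPairClassAt L Qm n → ∃ (X Nm : Matrix (TorusSite 2 L) (TorusSite 2 L) ℂ) (w₁ : TorusSite 2 L → ℝ) (Ea E₁ : TorusSite 2 L → TorusSite 2 L → ℝ) (r' e₁ : ℝ), 0 ≤ r' ∧ 0 ≤ e₁ ∧ (∀ x y, ¬(x ∈ klBall L μ 0 ∧ y ∈ klBall L μ 0) → X x y = 0) ∧ (∀ k ∈ klBall L μ 0, ∀ k' ∈ klBall L μ 0, X k
                  k' = klCovSmearedPairAmplitude L M β U μ (klFlowFrameU L M β U μ (n - 1)) (n - 1) (softCovOf L M β μ (klFlowFrameU L M β U μ (n - 1)) (softSymbolCompl L M β μ (klFlowFrameU L M β U μ (n - 1)) (n - 1) n)) Qm k k') ∧ (∀ x y, 0 ≤ Ea x y) ∧ (1 + Matrix.diagonal (fun p => (w₁ p : ℂ)) * X) * Nm = 1 ∧ (∀ k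
                  ∈ klBall L μ 0, ∀ k' ∈ klBall L μ 0, ‖klPairArrayF L M β U μ n Qm k k' - (X * Nm) k k'‖ ≤ Ea k k') ∧ (∀ x y, transferBarRelIdx L klEngGeoTh P (klCT8 P R (klEngQ7 P R) klEngGeo14 klEngGeoTh) β U (n - 1) (n - 1) Qm x y ≤ r') ∧ (∀ x y, Ea x y + (transferBarRelIdx L klEngGeoTh P (klCT8 P R (klEngQ7 P R)
                  klEngGeo14 klEngGeoTh) β U (n - 1) (n - 1) Qm x y + 3 / 2 * (3 / 2 * m) * ∑ t, transferBarRelIdx L klEngGeoTh P (klCT8 P R (klEngQ7 P R) klEngGeo14 klEngGeoTh) β U (n - 1) (n - 1) Qm x t * |w₁ t| + 3 / 2 * (3 / 2 * m + r') * ∑ a, |w₁ a| * transferBarRelIdx L klEngGeoTh P (klCT8 P R (klEngQ7 P R)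
                  klEngGeo14 klEngGeoTh) β U (n - 1) (n - 1) Qm a y + 9 / 4 * (3 / 2 * m + r') * (3 / 2 * m) * ∑ a, ∑ t, |w₁ a| * transferBarRelIdx L klEngGeoTh P (klCT8 P R (klEngQ7 P R) klEngGeo14 klEngGeoTh) β U (n - 1) (n - 1) Qm a t * |w₁ t|) ≤ E₁ x y) ∧ (∀ x y, E₁ x y ≤ e₁) ∧ (3 / 2 * m + r') * ∑ a, |w₁ a| ≤ 1 /
                  3 ∧ (∑ p, |w₁ p| ≤ 3 / 4 * klEngGeo14.bhi) ∧ (∑ p, (|w₁ p| - w₁ p) ≤ klEdge klEngGeo14 n (klTorusNorm L Qm)) ∧ (∀ k ∈ klBall L μ 0, ∀ k' ∈ klBall L μ 0, E₁ k k' ≤ drivePBar klEngGeo14 P U (n - 1) + eremBar klEngGeo14 P (klEngQ9dG klEngGeo14 P R) U β L (n - 1) + thermalBar klEngGeo14 P U β n +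
                  legDressBarQ2 klEngGeo14 P (klEngQ9dG klEngGeo14 P R) U n (legSliceCountT L β μ (klFlowFrameU L M β U μ n) n ![k', Qm - k', Qm - k, k]) + (P.Klam * U) ^ 2 * (klEngGeo14.phGain n (klTorusNorm L (k - k')) + klEngGeo14.phGain n (klTorusNorm L (k + k' - Qm))) + frameShiftBar P (klEngQ9dG klEngGeo14 P R)
                  U n)) := by
  intro P R c hP hR hc hc3 μ hμ U hU hUle β hβ hβc L M _ _ hL hM n hn1 hn hreg hhist hfr hV4 hlev hlevU hiso htr
  obtain ⟨n', rfl⟩ : ∃ n', n = n' + 1 := ⟨n - 1, by omega⟩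
  obtain ⟨m, hm, hC₀, hsm₀, hZ, htow⟩ :=
    hexLadG P R c hP hR hc hc3 μ hμ U hU hUle β hβ hβc L M hL hM (n' + 1) hn1 hn hreg hhist hfr hV4 hlev hlevU hiso htr n' rfl
  clear hexLadG
  have hβL : β ≤ (L : ℝ) := le_of_klEngL₄_le hL
  have hG : (2 : ℝ) ^ 19 ≤ klEngGeo14.bhi := by rw [klEngGeo14_bhi_eq]; norm_num
  have hm7 : 3 / 2 * m * 738288 ≤ 1 / 3 := by
    have h := hsm₀; rw [klEngGeo14_bhi_eq] at h; norm_num at h; linarith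
  -- the two-shell regime kit of «PH-PROFILE» from row (c)'s prefix
  have hUu2 : U ≤ klTSU R := rowC_hUu klEngGeo14 hUle
  obtain ⟨-, hGL⟩ := rowC_hGL klEngGeo14 hR hU hUle hβ hL
  have hj'β : Real.pi / (4 * β) ≤ klScale klE0 (n' + 1) := pi_div_four_mul_le_klScale_of_le_nScales_succ hβ hn
  have hGfr : 0 ≤ R.Gfr 1 := hR.wf.2.2 1
  have hβ0 : 0 < β := KLRegimeSplit.pos_of_klBetaMin_le hβ
  have hL0 : (0 : ℝ) < L := lt_of_lt_of_le (by positivity) hGL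
  have hGδ : (4 + 8 / 3 * R.Gfr 1 * U ^ 2) * (2 * Real.pi / L) ≤ klScale klE0 (n' + 1) := by
    refine le_trans ?_ hj'β
    rw [← mul_div_assoc, div_le_div_iff₀ hL0 (by positivity)]
    nlinarith [Real.pi_pos]
  have hE0c : 1 ≤ n' → 2 * klScale klE0 n' + (4 + 8 / 3 * R.Gfr 1 * U ^ 2) * (2 * Real.pi / L) ≤ klE0 := fun hn1' =>
    (tail_regime_readings β hR hβ hn1' (by omega) hGL).2.2
  simp only [Nat.add_sub_cancel]
  exact ⟨m, hm, hC₀, hsm₀, klmt_htower_family_grid L M hm hm7 hfr hβ hβL hG hZ twoShellFrameAreaAt_klTS klTS_nonneg hR hU hUu2 hμ hj'β hGδ hE0c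
    _ _ _ _ _ _ _ _ _ _ _ _ rfl rfl rfl rfl rfl rfl rfl rfl rfl rfl rfl rfl
    (fun Qm x y => transferBarRelIdx L klEngGeoTh P (klCT8 P R (klEngQ7 P R) klEngGeo14 klEngGeoTh) β U n' n' Qm x y)
    (fun Qm k k' => drivePBar klEngGeo14 P U n' + eremBar klEngGeo14 P (klEngQ9dG klEngGeo14 P R) U β L n' + thermalBar klEngGeo14 P U β (n' + 1) +
              legDressBarQ2 klEngGeo14 P (klEngQ9dG klEngGeo14 P R) U (n' + 1) (legSliceCountT L β μ (klFlowFrameU L M β U μ (n' + 1)) (n' + 1) ![k', Qm - k', Qm - k, k]) +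
              (P.Klam * U) ^ 2 * (klEngGeo14.phGain (n' + 1) (klTorusNorm L (k - k')) + klEngGeo14.phGain (n' + 1) (klTorusNorm L (k + k' - Qm))) +
              frameShiftBar P (klEngQ9dG klEngGeo14 P R) U (n' + 1))
    (htow _ _ _ _ _ _ _ _ _ _ _ _ rfl rfl rfl rfl rfl rfl rfl rfl rfl rfl rfl rfl)⟩

end LadTowerG

end Summit.HubbardSuperconductivity.HubbardSuperconductivity.Theorems.EngineV8

end
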